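import Literature.NumberTheory.PAdicHodge.AinfRamified
import Literature.NumberTheory.PAdicHodge.FontaineThetaKernel
import Mathlib.RingTheory.WittVector.Complete
import HarnessLib

/-!
# `A_inf(𝒪) = 𝔸_inf(F)[ϖ]`: the tilt `ϖ♭`, the degree-one primitive element `ω = ϖ − [ϖ♭]`, and
# `ker θ_𝒪 = ω · A_inf(𝒪)`

Topic `Literature/NumberTheory/PAdicHodge`; sequel of `AinfRamified` (`A_inf(𝒪)`, `θ_𝒪`) and `FontaineThetaKernel`
(`p♭`, `ξ = [p♭] − p`, `ker θ = ξ 𝔸_inf`).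

For an Eisenstein root datum `D = (f, ϖ)` over the `p`-adic field `F` (`e = deg f`):

* §1 **`𝒪_{ℂ_F}♭` is a valuation ring for `y ↦ ‖y♯‖`**: if `‖z♯‖ ≤ ‖y♯‖` and `y♯ ≠ 0` then `y ∣ z`
  (`PreTilt.exists_eq_mul_of_norm_untilt_le`; the tree's `exists_eq_pFlat_mul_of_coeff_zero_eq_zero` is the case
  `y = p♭`): the quotients of the canonical `pⁿ`-th roots `ỹₙ, z̃ₙ ∈ 𝒪_{ℂ_F}` form a compatible system.
* §2 **the tilt `ϖ♭ = (ϖ^{1/pⁿ} mod p)ₙ ∈ 𝒪_{ℂ_F}♭`** of the root (compatible roots taken in `F̄`), `(ϖ♭)♯ = ϖ`,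
  `θ([ϖ♭]) = ϖ`, and **`(ϖ♭)^e = p♭ · unit`** (both untilt to elements of absolute value `‖p‖`).
* §3 **`ω = ϖ − [ϖ♭] ∈ ker θ_𝒪`** — a primitive element of degree one of Fargues–Fontaine — and
  **`f([ϖ♭]) = ξ · unit` in `𝔸_inf(F)`** (`θ(f([ϖ♭])) = f(ϖ) = 0`, and modulo `p` one has `f ≡ X^e`, so
  `f([ϖ♭]) mod p = (ϖ♭)^e = p♭ · unit = (ξ mod p) · unit`; units lift along the `p`-adically complete `𝔸_inf`).
* §4 **`ker θ_𝒪 = ω · A_inf(𝒪)`** (`ker_theta_eq_span_omega`): `ξ ∈ ω A_inf(𝒪)` since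
  `ξ · unit = f([ϖ♭]) − f(ϖ)` is divisible by `[ϖ♭] − ϖ`; and an element of `ker θ_𝒪` is, modulo `ω`, an
  element of `ker θ = ξ 𝔸_inf`. Hence `σ(ω) ∈ ω A_inf(𝒪)`
  (`A_inf(𝒪)/ω ≅ 𝒪_{ℂ_F}` is recorded in the sequel).

Definitions (reviewed): `EisensteinRoot.rootSeq`, `.rootSeqC`, `.rootFlat` (the tilt `ϖ♭`), `AinfRam.omega`.
No named facts, no `sorry`, no instances. Completeness and the injectivity of `ι_𝒪 : A_inf(𝒪) → B_dR⁺` are the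
sequel `AinfRamifiedComplete`. Infrastructure for hDR over a ramified base; nothing about elliptic curves here.

## References
* [FarguesFontaine2018] L. Fargues, J.-M. Fontaine, Astérisque 406 (2018), §1.2 (`W_{𝒪_E}`), §2.2 (primitive elements
  of degree one, Déf. 2.2.1, and `θ`, Cor. 2.2.8: `W_{𝒪_E}(𝒪_F)/(π − [π♭])`-type untilts).
* [FontaineAsterisque223III] J.-M. Fontaine, Astérisque 223 (1994), Exp. II §1.2.2 (`ker θ = (ξ)`, the criterion
  for generators of `ker θ`).
* [FontaineOuyang2022] J.-M. Fontaine, Y. Ouyang, *Theory of p-adic Galois representations*, Prop. 4.3.3, Prop. 4.4.3.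
-/

noncomputable section

open ValuativeRel Field Ideal WittVector Polynomial

namespace Literature.NumberTheory.PAdicHodge

open Literature.NumberTheory.GaloisRepresentations
open Literature.NumberTheory.GaloisRepresentations.IsNonarchimedeanLocalField

variable {F : Type} [Field F] [ValuativeRel F] [TopologicalSpace F] [IsNonarchimedeanLocalField F]
  {p : ℕ} [Fact p.Prime]

/-! ## §1 Divisibility in `𝒪_{ℂ_F}♭` from the absolute values of untilts -/

section Tilt

variable [Fact (¬ IsUnit (p : integerC F))] [IsAdicComplete (Ideal.span {(p : integerC F)}) (integerC F)]

/-- The canonical `pⁿ`-th root `ỹₙ = (φ⁻ⁿ y)♯` of `y♯` is nonzero when `y♯` is. [cite: FontaineOuyang2022, Prop. 4.3.3] -/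
theorem PreTilt.untilt_frobeniusEquiv_symm_ne_zero {y : PreTilt (integerC F) p}
    (hy : ((PreTilt.untilt y : integerC F) : CompletedAlgClosure F) ≠ 0) (n : ℕ) :
    ((PreTilt.untilt (((frobeniusEquiv (PreTilt (integerC F) p) p).symm^[n]) y) : integerC F) : CompletedAlgClosure F) ≠ 0 := by
  intro h
  have h1 := norm_untilt_frobeniusEquiv_symm_pow (F := F) (p := p) y n
  rw [h, norm_zero, zero_pow (pow_ne_zero _ (Fact.out : p.Prime).ne_zero)] at h1
  exact norm_ne_zero_iff.2 hy h1.symm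

/-- `‖z̃ₙ‖ ≤ ‖ỹₙ‖` for all `n` as soon as `‖z♯‖ ≤ ‖y♯‖` (take `pⁿ`-th roots). [cite: FontaineOuyang2022, Prop. 4.3.3] -/
theorem PreTilt.norm_untilt_frobeniusEquiv_symm_le {y z : PreTilt (integerC F) p}
    (h : ‖((PreTilt.untilt z : integerC F) : CompletedAlgClosure F)‖ ≤ ‖((PreTilt.untilt y : integerC F) : CompletedAlgClosure F)‖)
    (n : ℕ) :
    ‖((PreTilt.untilt (((frobeniusEquiv (PreTilt (integerC F) p) p).symm^[n]) z) : integerC F) : CompletedAlgClosure F)‖ ≤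
      ‖((PreTilt.untilt (((frobeniusEquiv (PreTilt (integerC F) p) p).symm^[n]) y) : integerC F) : CompletedAlgClosure F)‖ := by
  refine le_of_pow_le_pow_left₀ (pow_ne_zero n (Fact.out : p.Prime).ne_zero) (norm_nonneg _) ?_
  rw [norm_untilt_frobeniusEquiv_symm_pow, norm_untilt_frobeniusEquiv_symm_pow]
  exact h

/-- The quotient sequence `w̃ₙ = z̃ₙ / ỹₙ ∈ 𝒪_{ℂ_F}`. [cite: FontaineOuyang2022, Prop. 4.3.3] -/
private def quotSeq {y z : PreTilt (integerC F) p}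
    (hy : ((PreTilt.untilt y : integerC F) : CompletedAlgClosure F) ≠ 0)
    (h : ‖((PreTilt.untilt z : integerC F) : CompletedAlgClosure F)‖ ≤ ‖((PreTilt.untilt y : integerC F) : CompletedAlgClosure F)‖)
    (n : ℕ) : integerC F :=
  ⟨((PreTilt.untilt (((frobeniusEquiv (PreTilt (integerC F) p) p).symm^[n]) z) : integerC F) : CompletedAlgClosure F) /
      ((PreTilt.untilt (((frobeniusEquiv (PreTilt (integerC F) p) p).symm^[n]) y) : integerC F) : CompletedAlgClosure F),
    (mem_integerC_iff).2 (by
      rw [norm_div, div_le_one (norm_pos_iff.2 (PreTilt.untilt_frobeniusEquiv_symm_ne_zero hy n))]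
      exact PreTilt.norm_untilt_frobeniusEquiv_symm_le h n)⟩

/-- `w̃ₙ₊₁^p = w̃ₙ`. [cite: FontaineOuyang2022, Prop. 4.3.3] -/
private theorem quotSeq_succ_pow {y z : PreTilt (integerC F) p}
    (hy : ((PreTilt.untilt y : integerC F) : CompletedAlgClosure F) ≠ 0)
    (h : ‖((PreTilt.untilt z : integerC F) : CompletedAlgClosure F)‖ ≤ ‖((PreTilt.untilt y : integerC F) : CompletedAlgClosure F)‖)
    (n : ℕ) : quotSeq hy h (n + 1) ^ p = quotSeq hy h n := by
  refine Subtype.ext ?_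
  change (_ / _) ^ p = _ / _
  rw [div_pow, ← SubmonoidClass.coe_pow, ← SubmonoidClass.coe_pow, untilt_frobeniusEquiv_symm_succ_pow,
    untilt_frobeniusEquiv_symm_succ_pow]

/-- `ỹₙ · w̃ₙ = z̃ₙ`. [cite: FontaineOuyang2022, Prop. 4.3.3] -/
private theorem mul_quotSeq {y z : PreTilt (integerC F) p}
    (hy : ((PreTilt.untilt y : integerC F) : CompletedAlgClosure F) ≠ 0)
    (h : ‖((PreTilt.untilt z : integerC F) : CompletedAlgClosure F)‖ ≤ ‖((PreTilt.untilt y : integerC F) : CompletedAlgClosure F)‖)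
    (n : ℕ) : PreTilt.untilt (((frobeniusEquiv (PreTilt (integerC F) p) p).symm^[n]) y) * quotSeq hy h n =
      PreTilt.untilt (((frobeniusEquiv (PreTilt (integerC F) p) p).symm^[n]) z) := by
  refine Subtype.ext ?_
  change _ * (_ / _) = _
  rw [mul_div_cancel₀ _ (PreTilt.untilt_frobeniusEquiv_symm_ne_zero hy n)]

/-- **`𝒪_{ℂ_F}♭` is a valuation ring for `y ↦ ‖y♯‖`**: if `y♯ ≠ 0` and `‖z♯‖ ≤ ‖y♯‖` then `z = y · w` for some
`w ∈ 𝒪_{ℂ_F}♭` — namely `w = (z̃ₙ / ỹₙ mod p)ₙ`. [cite: FontaineOuyang2022, Prop. 4.3.3] [cite: FarguesFontaine2018, §2.2] -/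
theorem PreTilt.exists_eq_mul_of_norm_untilt_le {y z : PreTilt (integerC F) p}
    (hy : ((PreTilt.untilt y : integerC F) : CompletedAlgClosure F) ≠ 0)
    (h : ‖((PreTilt.untilt z : integerC F) : CompletedAlgClosure F)‖ ≤ ‖((PreTilt.untilt y : integerC F) : CompletedAlgClosure F)‖) :
    ∃ w : PreTilt (integerC F) p, z = y * w := by
  refine ⟨⟨fun n => Ideal.Quotient.mk _ (quotSeq hy h n), fun n => by rw [← map_pow, quotSeq_succ_pow]⟩, ?_⟩
  refine Perfection.ext fun n => ?_
  change PreTilt.coeff n z = PreTilt.coeff n (y * _)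
  rw [map_mul, ← mk_untilt_frobeniusEquiv_symm, ← mk_untilt_frobeniusEquiv_symm]
  change _ = _ * Ideal.Quotient.mk _ (quotSeq hy h n)
  rw [← map_mul, mul_quotSeq]

/-- **Elements of `𝒪_{ℂ_F}♭` whose untilts have the same absolute value are associate** (`𝒪_{ℂ_F}♭` is a domain).
[cite: FontaineOuyang2022, Prop. 4.3.3] -/
theorem PreTilt.exists_unit_eq_mul_of_norm_untilt_eq {y z : PreTilt (integerC F) p}
    (hy : ((PreTilt.untilt y : integerC F) : CompletedAlgClosure F) ≠ 0)
    (h : ‖((PreTilt.untilt z : integerC F) : CompletedAlgClosure F)‖ = ‖((PreTilt.untilt y : integerC F) : CompletedAlgClosure F)‖) :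
    ∃ u : (PreTilt (integerC F) p)ˣ, z = y * u := by
  have hz : ((PreTilt.untilt z : integerC F) : CompletedAlgClosure F) ≠ 0 := fun h0 => by
    rw [h0, norm_zero] at h; exact hy (norm_eq_zero.1 h.symm)
  obtain ⟨w, hw⟩ := PreTilt.exists_eq_mul_of_norm_untilt_le hy h.le
  obtain ⟨w', hw'⟩ := PreTilt.exists_eq_mul_of_norm_untilt_le hz h.ge
  have hy0 : y ≠ 0 := fun h0 => hy (by
    rw [h0, show PreTilt.untilt (0 : PreTilt (integerC F) p) = 0 from Perfection.teichmuller_zero]; rfl)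
  have h1 : y * (w * w' - 1) = 0 := by
    rw [mul_sub, mul_one, ← mul_assoc, ← hw, ← hw', sub_self]
  have h2 : w * w' = 1 := sub_eq_zero.1 ((mul_eq_zero.1 h1).resolve_left hy0)
  exact ⟨Units.mkOfMulEqOne w w' h2, hw⟩

end Tilt

section Units

variable [Fact (¬ IsUnit (p : integerC F))]

/-- **Units of `𝔸_inf(F)` are detected modulo `p`**: `a` is a unit as soon as `a mod p ∈ 𝒪_{ℂ_F}♭` is (`𝔸_inf` is
`p`-adically complete, so `p` lies in the Jacobson radical). [cite: FontaineOuyang2022, Prop. 4.4.3] -/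
theorem Ainf.isUnit_of_isUnit_constantCoeff {a : Ainf (p := p) F} (ha : IsUnit (WittVector.constantCoeff a)) : IsUnit a := by
  obtain ⟨c, hc⟩ := ha.exists_right_inv
  set b : Ainf (p := p) F := teichmuller p c with hb
  have h1 : (a * b - 1).coeff 0 = 0 := by
    rw [← WittVector.constantCoeff_apply, map_sub, map_mul, map_one, hb, WittVector.constantCoeff_apply (teichmuller p c),
      teichmuller_coeff_zero, hc, sub_self]
  have h2 : a * b - 1 ∈ Ideal.span {(p : Ainf (p := p) F)} := (mem_span_p_iff_coeff_zero_eq_zero _).2 h1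
  have h3 : a * b - 1 ∈ (⊥ : Ideal (Ainf (p := p) F)).jacobson := IsAdicComplete.le_jacobson_bot _ h2
  have h4 : IsUnit ((a * b - 1) * 1 + 1) := Ideal.mem_jacobson_bot.1 h3 1
  rw [mul_one, sub_add_cancel] at h4
  exact isUnit_of_mul_isUnit_left h4

end Units

/-! ## §2 The tilt `ϖ♭` of the root -/

namespace EisensteinRoot

variable [CharZero F] {hp : valuation F p < 1}

/-- **A compatible system of `pⁿ`-th roots of `ϖ` in `F̄`**: `ϖ₀ = ϖ`, `ϖₙ₊₁^p = ϖₙ` (roots exist since `F̄` is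
algebraically closed). [cite: FontaineOuyang2022, §4.3] -/
def rootSeq (D : EisensteinRoot F p hp) : ℕ → NormedAlgClosure F
  | 0 => algebraMap F (NormedAlgClosure F) D.root
  | n + 1 => Classical.choose (IsAlgClosed.exists_pow_nat_eq (rootSeq D n) (Fact.out : p.Prime).pos)

variable (D : EisensteinRoot F p hp)

/-- `ϖₙ₊₁^p = ϖₙ`. [cite: FontaineOuyang2022, §4.3] -/
theorem rootSeq_succ_pow (n : ℕ) : D.rootSeq (n + 1) ^ p = D.rootSeq n :=
  Classical.choose_spec (IsAlgClosed.exists_pow_nat_eq (D.rootSeq n) (Fact.out : p.Prime).pos)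

/-- `ϖₙ ^ pⁿ = ϖ`. [cite: FontaineOuyang2022, §4.3] -/
theorem rootSeq_pow (n : ℕ) : D.rootSeq n ^ p ^ n = algebraMap F (NormedAlgClosure F) D.root := by
  induction n with
  | zero => rw [pow_zero, pow_one]; rfl
  | succ n ih => rw [pow_succ', pow_mul, rootSeq_succ_pow, ih]

/-- `ϖₙ ^ pⁿ = ϖ` in `ℂ_F`. [cite: FontaineOuyang2022, §4.3] -/
theorem coe_rootSeq_pow (n : ℕ) :
    ((D.rootSeq n : NormedAlgClosure F) : CompletedAlgClosure F) ^ p ^ n = algebraMap F (CompletedAlgClosure F) D.root := by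
  change (UniformSpace.Completion.coeRingHom : NormedAlgClosure F →+* CompletedAlgClosure F) (D.rootSeq n) ^ p ^ n = _
  rw [← map_pow, rootSeq_pow, CompletedAlgClosure.algebraMap_eq_coe]; rfl

/-- `‖ϖₙ‖ ^ pⁿ = ‖ϖ‖` in `ℂ_F`. [cite: FontaineOuyang2022, §4.3] -/
theorem norm_coe_rootSeq_pow (n : ℕ) :
    ‖((D.rootSeq n : NormedAlgClosure F) : CompletedAlgClosure F)‖ ^ p ^ n = ‖algebraMap F (CompletedAlgClosure F) D.root‖ := by
  rw [← norm_pow, coe_rootSeq_pow]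

/-- `‖ϖₙ‖ ≤ 1`. [cite: FontaineOuyang2022, §4.3] -/
theorem norm_coe_rootSeq_le_one (n : ℕ) : ‖((D.rootSeq n : NormedAlgClosure F) : CompletedAlgClosure F)‖ ≤ 1 := by
  by_contra hlt
  have h1 : 1 < ‖((D.rootSeq n : NormedAlgClosure F) : CompletedAlgClosure F)‖ ^ p ^ n :=
    one_lt_pow₀ (not_le.1 hlt) (pow_ne_zero _ (Fact.out : p.Prime).ne_zero)
  rw [norm_coe_rootSeq_pow] at h1
  exact absurd D.norm_algebraMap_root_le_one (not_le.2 h1)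

/-- **`ϖ^{1/pⁿ} ∈ 𝒪_{ℂ_F}`.** [cite: FontaineOuyang2022, §4.3] -/
def rootSeqC (n : ℕ) : integerC F :=
  ⟨((D.rootSeq n : NormedAlgClosure F) : CompletedAlgClosure F), (mem_integerC_iff).2 (D.norm_coe_rootSeq_le_one n)⟩

/-- Unfolding `rootSeqC`. [cite: FontaineOuyang2022, §4.3] -/
theorem coe_rootSeqC (n : ℕ) :
    ((D.rootSeqC n : integerC F) : CompletedAlgClosure F) = ((D.rootSeq n : NormedAlgClosure F) : CompletedAlgClosure F) := rfl

/-- `ϖₙ₊₁^p = ϖₙ` in `𝒪_{ℂ_F}`. [cite: FontaineOuyang2022, §4.3] -/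
theorem rootSeqC_succ_pow (n : ℕ) : D.rootSeqC (n + 1) ^ p = D.rootSeqC n := by
  refine Subtype.ext ?_
  rw [SubmonoidClass.coe_pow, coe_rootSeqC, coe_rootSeqC]
  change (UniformSpace.Completion.coeRingHom : NormedAlgClosure F →+* CompletedAlgClosure F) (D.rootSeq (n + 1)) ^ p =
    (UniformSpace.Completion.coeRingHom : NormedAlgClosure F →+* CompletedAlgClosure F) (D.rootSeq n)
  rw [← map_pow, rootSeq_succ_pow]

/-- `ϖₙ ^ pⁿ = ϖ` in `𝒪_{ℂ_F}`. [cite: FontaineOuyang2022, §4.3] -/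
theorem rootSeqC_pow (n : ℕ) : D.rootSeqC n ^ p ^ n = D.rootC := by
  refine Subtype.ext ?_
  rw [SubmonoidClass.coe_pow, coe_rootSeqC, coe_rootSeq_pow, coe_rootC]

variable [Fact (¬ IsUnit (p : integerC F))]

/-- **The tilt `ϖ♭ = (ϖ^{1/pⁿ} mod p)ₙ ∈ 𝒪_{ℂ_F}♭` of the root.** [cite: FarguesFontaine2018, §2.2] [cite: FontaineOuyang2022, §4.3] -/
def rootFlat : PreTilt (integerC F) p :=
  ⟨fun n => Ideal.Quotient.mk _ (D.rootSeqC n), fun n => by rw [← map_pow, rootSeqC_succ_pow]⟩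

/-- Coefficients of `ϖ♭`. [cite: FontaineOuyang2022, §4.3] -/
@[simp] theorem coeff_rootFlat (n : ℕ) : PreTilt.coeff n D.rootFlat = Ideal.Quotient.mk _ (D.rootSeqC n) := rfl

variable [IsAdicComplete (Ideal.span {(p : integerC F)}) (integerC F)]

/-- **`(ϖ♭)♯ = ϖ`.** [cite: FarguesFontaine2018, §2.2] [cite: FontaineOuyang2022, §4.3] -/
theorem untilt_rootFlat : PreTilt.untilt D.rootFlat = D.rootC := by
  change Perfection.teichmuller p (Ideal.span {(p : integerC F)}) D.rootFlat = _
  refine Perfection.teichmuller_spec fun n => ⟨D.rootSeqC n, rfl, ?_⟩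
  rw [rootSeqC_pow]
  exact SModEq.refl (M := integerC F) _

/-- **`θ([ϖ♭]) = ϖ`.** [cite: FarguesFontaine2018, §2.2] [cite: FontaineAsterisque223III, Exp. II §1.2.2] -/
theorem fontaineTheta_teichmuller_rootFlat : fontaineTheta (integerC F) p (teichmuller p D.rootFlat) = D.rootC := by
  rw [fontaineTheta_teichmuller, untilt_rootFlat]

/-- `‖((ϖ♭)^e)♯‖ = ‖p‖ = ‖(p♭)♯‖`. [cite: FontaineOuyang2022, §4.3] -/
theorem norm_untilt_rootFlat_pow :
    ‖((PreTilt.untilt (D.rootFlat ^ D.e) : integerC F) : CompletedAlgClosure F)‖ =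
      ‖((PreTilt.untilt (pFlat : PreTilt (integerC F) p) : integerC F) : CompletedAlgClosure F)‖ := by
  rw [map_pow, untilt_rootFlat, untilt_pFlat, SubmonoidClass.coe_pow, norm_pow, D.norm_rootC_pow, coe_natCast_integerC]

/-- **`(ϖ♭)^e = p♭ · u` for a unit `u` of `𝒪_{ℂ_F}♭`** (`‖(ϖ^e)‖ = ‖p‖`, and `𝒪_{ℂ_F}♭` is a valuation ring
for `‖·♯‖`). [cite: FarguesFontaine2018, §2.2] [cite: FontaineOuyang2022, Prop. 4.3.3] -/
theorem exists_rootFlat_pow_eq_pFlat_mul :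
    ∃ u : (PreTilt (integerC F) p)ˣ, D.rootFlat ^ D.e = (pFlat : PreTilt (integerC F) p) * (u : PreTilt (integerC F) p) := by
  have hp0 : ((PreTilt.untilt (pFlat : PreTilt (integerC F) p) : integerC F) : CompletedAlgClosure F) ≠ 0 := by
    rw [untilt_pFlat, coe_natCast_integerC]; exact natCast_C_ne_zero (F := F) (Fact.out : p.Prime).ne_zero
  exact PreTilt.exists_unit_eq_mul_of_norm_untilt_eq hp0 D.norm_untilt_rootFlat_pow

end EisensteinRoot

/-! ## §3 `ω = ϖ − [ϖ♭]` and `f([ϖ♭]) = ξ · unit` -/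

namespace AinfRam

variable [CharZero F] [Fact (¬ IsUnit (p : integerC F))] {hp : valuation F p < 1} (D : EisensteinRoot F p hp)

/-- **The degree-one primitive element `ω = ϖ − [ϖ♭] ∈ A_inf(𝒪)`** (Fargues–Fontaine), the generator of
`ker θ_𝒪` — the analogue of `ξ = [p♭] − p` for the uniformizer `ϖ` in place of `p`.
[cite: FarguesFontaine2018, §2.2 (Déf. 2.2.1)] -/
def omega : AinfRam D := varpi D - algebraMap (Ainf (p := p) F) (AinfRam D) (teichmuller p D.rootFlat)

/-- Unfolding `ω`. [cite: FarguesFontaine2018, §2.2] -/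
theorem omega_def : omega D = varpi D - algebraMap (Ainf (p := p) F) (AinfRam D) (teichmuller p D.rootFlat) := rfl
/-- `ω` is the class of the polynomial `X − [ϖ♭]`. [cite: FarguesFontaine2018, §2.2] -/
theorem mk_X_sub_C : AdjoinRoot.mk D.polyAinf (X - C (teichmuller p D.rootFlat)) = omega D := by
  rw [map_sub, AdjoinRoot.mk_X, AdjoinRoot.mk_C, omega_def, varpi, algebraMap_eq]

/-- **`f([ϖ♭]) = [ϖ♭]^e + p·b` in `𝔸_inf(F)`**: modulo `p` the Eisenstein polynomial is `X^e`.
[cite: SerreLocalFields1979, Ch. I §6 Prop. 17] -/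
theorem exists_eval_teichmuller_rootFlat_eq :
    ∃ b : Ainf (p := p) F, D.polyAinf.eval (teichmuller p D.rootFlat) = teichmuller p D.rootFlat ^ D.e + (p : Ainf (p := p) F) * b := by
  set x := teichmuller p D.rootFlat with hx
  choose d hd using fun i : Finset.range D.e => D.dvd_coeff (Finset.mem_range.1 i.2)
  refine ⟨∑ i : Finset.range D.e, zpToAinf (d i) * x ^ (i : ℕ), ?_⟩
  rw [Polynomial.eval_eq_sum_range, D.natDegree_polyAinf, Finset.sum_range_succ]
  have hlead : D.polyAinf.coeff D.e = 1 := by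
    have h := D.monic_polyAinf
    rw [Polynomial.Monic, Polynomial.leadingCoeff, D.natDegree_polyAinf] at h
    exact h
  rw [hlead, one_mul, add_comm, add_right_inj, Finset.mul_sum, ← Finset.sum_coe_sort]
  refine Finset.sum_congr rfl fun i _ => ?_
  rw [EisensteinRoot.polyAinf_def, Polynomial.coeff_map, hd i, map_mul, map_natCast, mul_assoc]

/-- Every element of `A_inf(𝒪)` is congruent modulo `ω` to an element of `𝔸_inf(F)`: the class of `q` is
`q([ϖ♭]) + ω · (class of the quotient of `q` by `X − [ϖ♭]`)`. [cite: FarguesFontaine2018, §2.2] -/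
theorem mk_eq_algebraMap_eval_add (q : (Ainf (p := p) F)[X]) :
    AdjoinRoot.mk D.polyAinf q = algebraMap (Ainf (p := p) F) (AinfRam D) (q.eval (teichmuller p D.rootFlat)) +
      omega D * AdjoinRoot.mk D.polyAinf (q /ₘ (X - C (teichmuller p D.rootFlat))) := by
  set a := teichmuller p D.rootFlat with ha
  have hq : q = C (q.eval a) + (X - C a) * (q /ₘ (X - C a)) := by
    conv_lhs => rw [← Polynomial.modByMonic_add_div q (X - C a), Polynomial.modByMonic_X_sub_C_eq_C_eval]
  conv_lhs => rw [hq]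
  rw [map_add, map_mul, AdjoinRoot.mk_C, mk_X_sub_C, algebraMap_eq]

variable [IsAdicComplete (Ideal.span {(p : integerC F)}) (integerC F)]

/-- **`θ_𝒪(ω) = ϖ − ϖ = 0`.** [cite: FarguesFontaine2018, §2.2] -/
theorem theta_omega : theta D (omega D) = 0 := by
  rw [omega_def, map_sub, theta_varpi, theta_algebraMap, D.fontaineTheta_teichmuller_rootFlat, sub_self]

/-- `ω ∈ ker θ_𝒪`. [cite: FarguesFontaine2018, §2.2] -/
theorem omega_mem_ker : omega D ∈ RingHom.ker (theta D) := theta_omega D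
/-- **`θ(f([ϖ♭])) = f(θ[ϖ♭]) = f(ϖ) = 0`.** [cite: FarguesFontaine2018, §2.2] -/
theorem fontaineTheta_eval_teichmuller_rootFlat :
    fontaineTheta (integerC F) p (D.polyAinf.eval (teichmuller p D.rootFlat)) = 0 := by
  rw [Polynomial.eval, Polynomial.hom_eval₂, RingHom.comp_id, D.fontaineTheta_teichmuller_rootFlat,
    EisensteinRoot.eval₂_polyAinf, fontaineTheta_comp_zpToAinf]
  exact D.eval₂_toIntC_rootC

/-- **`f([ϖ♭]) = ξ · u` with `u` a unit of `𝔸_inf(F)`** — Fontaine's criterion for generators of `ker θ`: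
`f([ϖ♭]) ∈ ker θ = ξ𝔸_inf`, and modulo `p` it is `(ϖ♭)^e = p♭ · unit = (ξ mod p) · unit`.
[cite: FontaineAsterisque223III, Exp. II §1.2.2] [cite: FarguesFontaine2018, §2.2] -/
theorem exists_unit_eval_teichmuller_rootFlat_eq :
    ∃ u : (Ainf (p := p) F)ˣ, D.polyAinf.eval (teichmuller p D.rootFlat) = xi * (u : Ainf (p := p) F) := by
  obtain ⟨a, ha⟩ := xi_dvd_of_fontaineTheta_eq_zero (fontaineTheta_eval_teichmuller_rootFlat D)
  obtain ⟨b, hb⟩ := exists_eval_teichmuller_rootFlat_eq D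
  obtain ⟨u₀, hu₀⟩ := D.exists_rootFlat_pow_eq_pFlat_mul
  have h1 : (pFlat : PreTilt (integerC F) p) * WittVector.constantCoeff a = pFlat * (u₀ : PreTilt (integerC F) p) := by
    have ha' := congrArg WittVector.constantCoeff ha
    have hb' := congrArg WittVector.constantCoeff hb
    rw [map_mul, constantCoeff_xi] at ha'
    rw [map_add, map_mul, map_pow, map_natCast, CharP.cast_eq_zero, zero_mul, add_zero,
      WittVector.constantCoeff_apply (teichmuller p D.rootFlat), teichmuller_coeff_zero, hu₀] at hb'
    rw [← ha', ← hb']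
  have h2 : WittVector.constantCoeff a = u₀ := mul_left_cancel₀ pFlat_ne_zero h1
  have h3 : IsUnit a := Ainf.isUnit_of_isUnit_constantCoeff (by rw [h2]; exact u₀.isUnit)
  exact ⟨h3.unit, by rw [IsUnit.unit_spec]; exact ha⟩

/-! ## §4 `ker θ_𝒪 = ω · A_inf(𝒪)` -/

/-- **`ξ ∈ ω · A_inf(𝒪)`**: `ξ · u = f([ϖ♭]) = f([ϖ♭]) − f(ϖ)` is divisible by `[ϖ♭] − ϖ = −ω`.
[cite: FarguesFontaine2018, §2.2] -/
theorem xi_mem_span_omega : algebraMap (Ainf (p := p) F) (AinfRam D) xi ∈ Ideal.span {omega D} := by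
  obtain ⟨u, hu⟩ := exists_unit_eval_teichmuller_rootFlat_eq D
  set g : (AinfRam D)[X] := D.polyAinf.map (algebraMap (Ainf (p := p) F) (AinfRam D)) with hg
  have h1 : g.eval (varpi D) = 0 := by rw [hg, Polynomial.eval_map]; exact eval₂_varpi D
  have h2 : g.eval (algebraMap (Ainf (p := p) F) (AinfRam D) (teichmuller p D.rootFlat)) =
      algebraMap (Ainf (p := p) F) (AinfRam D) xi * algebraMap (Ainf (p := p) F) (AinfRam D) (u : Ainf (p := p) F) := by
    rw [hg, Polynomial.eval_map, Polynomial.eval₂_hom, hu, map_mul]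
  have h3 := Polynomial.sub_dvd_eval_sub (varpi D) (algebraMap (Ainf (p := p) F) (AinfRam D) (teichmuller p D.rootFlat)) g
  rw [h1, h2, zero_sub, ← omega_def, dvd_neg] at h3
  rw [Ideal.mem_span_singleton]
  exact (IsUnit.dvd_mul_right (u.isUnit.map _)).1 h3

/-- **`ker θ_𝒪 = ω · A_inf(𝒪)`** (Fargues–Fontaine: a primitive element of degree one generates the kernel of
`θ`). If `θ_𝒪(x) = 0`, write `x = r + ω t` with `r ∈ 𝔸_inf(F)`; then `θ(r) = 0`, so `r ∈ ξ𝔸_inf ⊆ ω A_inf(𝒪)`.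
[cite: FarguesFontaine2018, §2.2 (Cor. 2.2.8)] [cite: FontaineAsterisque223III, Exp. II §1.2.2] -/
theorem ker_theta_eq_span_omega : RingHom.ker (theta D) = Ideal.span {omega D} := by
  refine le_antisymm (fun x hx => ?_) ((Ideal.span_singleton_le_iff_mem _).2 (omega_mem_ker D))
  rw [RingHom.mem_ker] at hx
  obtain ⟨q, rfl⟩ := AdjoinRoot.mk_surjective x
  have hθ : fontaineTheta (integerC F) p (q.eval (teichmuller p D.rootFlat)) = 0 := by
    rw [mk_eq_algebraMap_eval_add, map_add, map_mul, theta_omega, zero_mul, add_zero, theta_algebraMap] at hx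
    exact hx
  obtain ⟨s, hs⟩ := xi_dvd_of_fontaineTheta_eq_zero hθ
  rw [mk_eq_algebraMap_eval_add, hs, map_mul]
  exact Ideal.add_mem _ (Ideal.mul_mem_right _ _ (xi_mem_span_omega D))
    (Ideal.mul_mem_right _ _ (Ideal.mem_span_singleton_self _))

/-- `θ_𝒪(x) = 0 ⟹ ω ∣ x`. [cite: FarguesFontaine2018, §2.2 (Cor. 2.2.8)] -/
theorem omega_dvd_of_theta_eq_zero {x : AinfRam D} (hx : theta D x = 0) : omega D ∣ x := by
  rw [← Ideal.mem_span_singleton, ← ker_theta_eq_span_omega]; exact hx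

/-- **`θ_𝒪(x) = 0 ↔ ω ∣ x`.** [cite: FarguesFontaine2018, §2.2 (Cor. 2.2.8)] -/
theorem theta_eq_zero_iff_omega_dvd (x : AinfRam D) : theta D x = 0 ↔ omega D ∣ x := by
  refine ⟨omega_dvd_of_theta_eq_zero D, fun ⟨c, hc⟩ => ?_⟩
  rw [hc, map_mul, theta_omega, zero_mul]

/-- `ξ = ω · c` in `A_inf(𝒪)` for some `c`. [cite: FarguesFontaine2018, §2.2] -/
theorem omega_dvd_xi : omega D ∣ algebraMap (Ainf (p := p) F) (AinfRam D) xi :=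
  Ideal.mem_span_singleton.1 (xi_mem_span_omega D)

/-- **`Γ_F` preserves `ω · A_inf(𝒪)`**: `σ(ω) = ϖ − [σ♭ ϖ♭] ∈ ker θ_𝒪 = ω A_inf(𝒪)`. [cite: FontaineAsterisque223III, Exp. II §1.2] -/
theorem omega_dvd_gal_omega (σ : absoluteGaloisGroup F) : omega D ∣ gal D σ (omega D) :=
  omega_dvd_of_theta_eq_zero D (theta_gal_eq_zero D σ (theta_omega D))

/-- `σ` maps `ω · A_inf(𝒪)` into itself. [cite: FontaineAsterisque223III, Exp. II §1.2] -/
theorem span_omega_map_gal_le (σ : absoluteGaloisGroup F) :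
    (Ideal.span {omega D}).map (gal D σ) ≤ Ideal.span {omega D} := by
  rw [Ideal.map_span, Set.image_singleton, Ideal.span_singleton_le_iff_mem, Ideal.mem_span_singleton]
  exact omega_dvd_gal_omega D σ

end AinfRam

end Literature.NumberTheory.PAdicHodge

end
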